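import Summits.CriticalPhenomena.SAWScalingLimit.Theses.SAWDevelopingMap
import Summits.CriticalPhenomena.SAWScalingLimit.Theorems.SAWDevelopingMapNoFoldBoundCollarTwo

/-!
# `NoFoldBound`, line Ideator3Sketch — the crux from four named inputs and `InteriorFlattening`

Crux `NoFoldBound` (stmt-CriticalPhenomena-8296), route `SAWDevelopingMap`, lead seat c5. The line has reduced the
crux to four named conjecture-grade inputs plus the sibling crux (M) `InteriorFlattening` (stmt-CriticalPhenomena-8297);
the skeleton proving this lives under `Cruxes/` with `sorry`d stubs and can be neither imported nor cited. This file
makes the reduction a CITABLE tree theorem, `noFoldBound_of_inputs`: the four inputs enter as hypotheses, byte-identical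
to the four stubs of the registered skeleton (v10), so that a planner can restate (K) as a conditional bridge on the
named inputs. The inputs and their status:

* `hL` (skeleton stub `stub_slitLoopFifth`) — the slit returning-loop series at criticality is `≤ 1/5`. Numerically
  `sup = 0.1175 ± 0.0015` against the threshold `1/5`; no proof: the Duminil-Copin–Smirnov linear relations alone do
  not bound it (DCS-LP barrier, `Theorems/NoFoldBound/Negative/BoundaryRay*.lean`).
* `hdom`, `hdomSrc` (stubs `stub_portDominance`, `stub_portDominanceSrc`) — middle-port dominance of the dressed
  first-arrival masses at depth-2 vertices, touching neighbour off the source / equal to the source vertex. Exact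
  enumeration: min ratio `3.109` on all domains of `≤ 79` vertices; Monte Carlo `≈ 2.6–2.7` up to `1630` vertices; a
  Harnack-type comparability with no tool in print.
* `h3` (stub `stub_collarDepthThree`) — slit coherence at the collar of depth `≥ 3` (interior vertices all of whose
  second neighbours lie in `Λ`, not `R`-deep), one `k_R < 1` for every radius `R`. First-arrival windings there fall in
  finite rigid bands (`chain_rigidity`), but no quantitative criterion is known.

Proof (≈ the skeleton's glue): depth `≤ 2` is the landed milestone `noFold_collarTwo hL hdom hdomSrc`; `R₀`-deep
vertices, `R₀` given by (M) at `ε = 1/2`, are flattened by `hM`; the rest (depth `≥ 3`, not `R₀`-deep) is `h3 R₀`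
through the pointwise interior reduction `interior_labellings_at` (port renewal `stub_portRenewal` + slit simple
connectivity `stub_slitSC`, both landed) — `depthThree_interior_of_hyp`. [folklore assembly]
-/

noncomputable section

open scoped BigOperators
open Literature.Probability.LatticeModels Literature.Probability.RandomPlanarGeometry.SAW

namespace Summit.CriticalPhenomena.SAWScalingLimit.Theorems.SAWDevelopingMapNoFoldBound

/-! ## Depth ≥ 3 in the crux's `F`-form -/

/-- **Depth ≥ 3 in the crux's `F`-form, from the depth-≥-3 slit-coherence input.** Given (h3) slit coherence at the
depth-≥-3 collar for every radius, for every radius `R` there is one `k < 1` such that at every vertex `v` off the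
source, all of whose neighbours and second neighbours lie in `Λ` (depth ≥ 3: then no neighbour is sealed, none is on
the source, none touches the complement) but which is NOT `R`-deep, every labelling satisfies the no-fold inequality:
`h3 R` gives slit coherence at the positive labellings and `interior_labellings_at` (port renewal + slit simple
connectivity, landed) turns it into the six labelled inequalities. [folklore assembly] -/
theorem depthThree_interior_of_hyp
    (h3 : ∀ R : ℝ, ∃ k : ℝ, k < 1 ∧ ∀ (Λ : Finset HexVertex), hexDomainSimplyConnected Λ →
      ∀ a ∈ hexDomainBoundary Λ, ∀ v ∈ Λ, v ∉ a → (∀ u : HexVertex, hexGraph.Adj v u → u ∈ Λ) →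
      (∀ w : HexVertex, hexGraph.Adj v w → ∃ y : HexVertex, hexGraph.Adj w y ∧ y ≠ v ∧ y ∈ Λ) →
      (∃ w : HexVertex, dist (hexCenter w) (hexCenter v) ≤ R ∧ w ∉ Λ) →
      (¬ ∃ w x : HexVertex, hexGraph.Adj v w ∧ hexGraph.Adj w x ∧ x ≠ v ∧ x ∉ Λ ∧ w ∉ a) →
      (¬ ∃ w : HexVertex, hexGraph.Adj v w ∧ w ∈ a) →
      ∀ w₀ w₁ w₂ : HexVertex, hexGraph.Adj v w₀ → hexGraph.Adj v w₁ → hexGraph.Adj v w₂ →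
      w₀ ≠ w₁ → w₁ ≠ w₂ → w₀ ≠ w₂ →
      winding [hexMidpoint s(w₀, v), hexCenter v, hexMidpoint s(v, w₁)] = Real.pi / 3 →
      let x : ℝ := hexCriticalFugacity
      let α : ℝ := 1 + 2 * hexCriticalFugacity * Real.cos (5 * Real.pi / 24)
      let β : ℝ := 1 + 2 * hexCriticalFugacity * Real.cos (11 * Real.pi / 24)
      let ω : ℂ := Complex.exp (2 * Real.pi * Complex.I / 3)
      let Z : (w p q : HexVertex) → HexMidEdgeSAW Λ a s(v, w) → ℝ :=
        fun w p q (γ : HexMidEdgeSAW Λ a s(v, w)) =>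
        ∑ δ : HexMidEdgeSAW ((Λ \ γ.verts.toFinset).erase v) s(v, p) s(v, q), x ^ δ.length
      let B : (w p q : HexVertex) → ℂ := fun w p q =>
        ∑ γ : HexMidEdgeSAW Λ a s(v, w), if v ∉ γ.verts then
          γ.weight x (5 / 8) * ((β + Real.sqrt 3 * x * Z w p q γ : ℝ) : ℂ) else 0
      let S : (w p q : HexVertex) → ℂ := fun w p q =>
        ∑ γ : HexMidEdgeSAW Λ a s(v, w), if v ∉ γ.verts then
          γ.weight x (5 / 8) * ((α - Real.sqrt 3 * x * Z w p q γ : ℝ) : ℂ) else 0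
      ‖B w₀ w₁ w₂ + ω * B w₁ w₂ w₀ + ω ^ 2 * B w₂ w₀ w₁‖ ≤
        k * ‖S w₀ w₁ w₂ + S w₁ w₂ w₀ + S w₂ w₀ w₁‖)
    (R : ℝ) :
    ∃ k : ℝ, k < 1 ∧ ∀ (Λ : Finset HexVertex), hexDomainSimplyConnected Λ →
      ∀ a ∈ hexDomainBoundary Λ, ∀ v ∈ Λ, v ∉ a → (∀ u : HexVertex, hexGraph.Adj v u → u ∈ Λ) →
      (∀ w x : HexVertex, hexGraph.Adj v w → hexGraph.Adj w x → x ≠ v → x ∈ Λ) →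
      (∃ w : HexVertex, dist (hexCenter w) (hexCenter v) ≤ R ∧ w ∉ Λ) →
      ∀ w₀ w₁ w₂ : HexVertex, hexGraph.Adj v w₀ → hexGraph.Adj v w₁ → hexGraph.Adj v w₂ →
      w₀ ≠ w₁ → w₁ ≠ w₂ → w₀ ≠ w₂ →
      let F : Sym2 HexVertex → ℂ := hexParafermionicObservable Λ a hexCriticalFugacity (5 / 8)
      let ω : ℂ := Complex.exp (2 * Real.pi * Complex.I / 3)
      ‖F s(v, w₀) + ω * F s(v, w₁) + ω ^ 2 * F s(v, w₂)‖ ≤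
        k * ‖F s(v, w₀) + F s(v, w₁) + F s(v, w₂)‖ := by
  obtain ⟨k₂, hk₂, H₂⟩ := h3 R
  refine ⟨max k₂ 0, max_lt hk₂ one_pos, ?_⟩
  intro Λ hΛ a ha v hv hva hint h2 hnd w₀ w₁ w₂ h₀ h₁ h₂ h₀₁ h₁₂ h₀₂
  -- no sealed neighbour, no touching neighbour, no neighbour on the source
  have hns : ∀ w : HexVertex, hexGraph.Adj v w → ∃ y : HexVertex, hexGraph.Adj w y ∧ y ≠ v ∧ y ∈ Λ := by
    intro w hw
    obtain ⟨y, hy, hyv⟩ := exists_adj_ne w v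
    exact ⟨y, hy, hyv, h2 w y hw hy hyv⟩
  have hnt : ¬ ∃ w x : HexVertex, hexGraph.Adj v w ∧ hexGraph.Adj w x ∧ x ≠ v ∧ x ∉ Λ ∧ w ∉ a := by
    rintro ⟨w, x, hvw, hwx, hxv, hx, -⟩
    exact hx (h2 w x hvw hwx hxv)
  have hnsrc : ¬ ∃ w : HexVertex, hexGraph.Adj v w ∧ w ∈ a := by
    rintro ⟨w, hvw, hwa⟩
    obtain ⟨he, u', v', hauv, hv', hu'⟩ := ha
    have hwΛ : w ∈ Λ := hint w hvw
    have hwv' : w = v' := by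
      rw [hauv] at hwa
      rcases Sym2.mem_iff.1 hwa with h' | h'
      · exact absurd (h' ▸ hwΛ) hu'
      · exact h'
    subst hwv'
    have hadj : hexGraph.Adj u' w := by
      rw [hauv] at he
      exact (SimpleGraph.mem_edgeSet hexGraph).1 he
    have hu'v : u' ≠ v := fun h => hu' (h ▸ hv)
    exact hu' (h2 w u' hvw hadj.symm hu'v)
  refine interior_labellings_at stub_portRenewal stub_slitSC hΛ ha hv hva ?_ h₀ h₁ h₂ h₀₁ h₁₂ h₀₂
  intro p q r hp hq hr hpq hqr hpr hchir
  have h := H₂ Λ hΛ a ha v hv hva hint hns hnd hnt hnsrc p q r hp hq hr hpq hqr hpr hchir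
  dsimp only at h ⊢
  exact h.trans (mul_le_mul_of_nonneg_right le_rfl (norm_nonneg _))

/-! ## The citable composition -/

/-- **The crux `NoFoldBound` from the four named inputs and the sibling crux `InteriorFlattening` (stmt-8297).**
Under (hL) slit returning loops `≤ 1/5`, (hdom)/(hdomSrc) middle-port dominance of the dressed first-arrival masses at
depth-2 vertices (touching neighbour off the source / equal to the source vertex), (h3) slit coherence at the collar
of depth `≥ 3` for every radius, and (hM) interior flattening, the parafermionic observable at `x_c`, `σ = 5/8` never
folds, uniformly: one `k < 1` for all simply connected `Λ`, all sources, all vertices, all labellings. Case split on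
the position of the vertex: within lattice distance `2` of the complement (`noFold_collarTwo hL hdom hdomSrc`) /
`R₀`-deep, `R₀` the radius given by (M) at `ε = 1/2` / the rest (`depthThree_interior_of_hyp h3 R₀`);
`k = max (max k₁ k₂) (1/2)`. [folklore assembly] -/
theorem noFoldBound_of_inputs
    (hL : ∀ (Λ : Finset HexVertex), hexDomainSimplyConnected Λ →
      ∀ u v w₁ w₂ : HexVertex, u ∉ Λ → v ∈ Λ → hexGraph.Adj v u → hexGraph.Adj v w₁ →
        hexGraph.Adj v w₂ → u ≠ w₁ → u ≠ w₂ → w₁ ≠ w₂ →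
        (∑ γ : HexMidEdgeSAW (Λ.erase v) s(v, w₁) s(v, w₂), hexCriticalFugacity ^ γ.length) ≤ 1 / 5)
    (hdom : ∀ (Λ : Finset HexVertex), hexDomainSimplyConnected Λ → ∀ a ∈ hexDomainBoundary Λ,
      ∀ v ∈ Λ, v ∉ a → ∀ w₀ w₁ w₂ x y : HexVertex, hexGraph.Adj v w₀ → hexGraph.Adj v w₁ →
      hexGraph.Adj v w₂ → w₀ ≠ w₁ → w₁ ≠ w₂ → w₀ ≠ w₂ → w₀ ∈ Λ → w₀ ∉ a →
      winding [hexMidpoint s(w₀, v), hexCenter v, hexMidpoint s(v, w₁)] = Real.pi / 3 →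
      hexGraph.Adj w₀ x → hexGraph.Adj w₀ y → v ≠ x → x ≠ y → v ≠ y → x ∉ Λ →
      let xc : ℝ := hexCriticalFugacity
      let α : ℝ := 1 + 2 * hexCriticalFugacity * Real.cos (5 * Real.pi / 24)
      let s : (w p q : HexVertex) → ℝ := fun w p q =>
        ∑ γ : HexMidEdgeSAW Λ a s(v, w), if v ∉ γ.verts then xc ^ γ.length *
          (α - Real.sqrt 3 * xc *
            ∑ δ : HexMidEdgeSAW ((Λ \ γ.verts.toFinset).erase v) s(v, p) s(v, q), xc ^ δ.length) else 0
      (winding [hexMidpoint s(y, w₀), hexCenter w₀, hexMidpoint s(w₀, v)] = Real.pi / 3 →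
          min (s w₀ w₁ w₂) (s w₂ w₀ w₁) ≤ s w₁ w₂ w₀) ∧
        (winding [hexMidpoint s(y, w₀), hexCenter w₀, hexMidpoint s(w₀, v)] = -(Real.pi / 3) →
          min (s w₀ w₁ w₂) (s w₁ w₂ w₀) ≤ s w₂ w₀ w₁))
    (hdomSrc : ∀ (Λ : Finset HexVertex), hexDomainSimplyConnected Λ → ∀ a ∈ hexDomainBoundary Λ,
      ∀ v ∈ Λ, v ∉ a → ∀ w₀ w₁ w₂ x y : HexVertex, hexGraph.Adj v w₀ → hexGraph.Adj v w₁ →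
      hexGraph.Adj v w₂ → w₀ ≠ w₁ → w₁ ≠ w₂ → w₀ ≠ w₂ → w₀ ∈ Λ → a = s(x, w₀) →
      winding [hexMidpoint s(w₀, v), hexCenter v, hexMidpoint s(v, w₁)] = Real.pi / 3 →
      hexGraph.Adj w₀ x → hexGraph.Adj w₀ y → v ≠ x → x ≠ y → v ≠ y → x ∉ Λ →
      let xc : ℝ := hexCriticalFugacity
      let α : ℝ := 1 + 2 * hexCriticalFugacity * Real.cos (5 * Real.pi / 24)
      let s : (w p q : HexVertex) → ℝ := fun w p q =>
        ∑ γ : HexMidEdgeSAW Λ a s(v, w), if v ∉ γ.verts then xc ^ γ.length *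
          (α - Real.sqrt 3 * xc *
            ∑ δ : HexMidEdgeSAW ((Λ \ γ.verts.toFinset).erase v) s(v, p) s(v, q), xc ^ δ.length) else 0
      (winding [hexMidpoint s(y, w₀), hexCenter w₀, hexMidpoint s(w₀, v)] = Real.pi / 3 →
          min (s w₀ w₁ w₂) (s w₂ w₀ w₁) ≤ s w₁ w₂ w₀) ∧
        (winding [hexMidpoint s(y, w₀), hexCenter w₀, hexMidpoint s(w₀, v)] = -(Real.pi / 3) →
          min (s w₀ w₁ w₂) (s w₁ w₂ w₀) ≤ s w₂ w₀ w₁))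
    (h3 : ∀ R : ℝ, ∃ k : ℝ, k < 1 ∧ ∀ (Λ : Finset HexVertex), hexDomainSimplyConnected Λ →
      ∀ a ∈ hexDomainBoundary Λ, ∀ v ∈ Λ, v ∉ a → (∀ u : HexVertex, hexGraph.Adj v u → u ∈ Λ) →
      (∀ w : HexVertex, hexGraph.Adj v w → ∃ y : HexVertex, hexGraph.Adj w y ∧ y ≠ v ∧ y ∈ Λ) →
      (∃ w : HexVertex, dist (hexCenter w) (hexCenter v) ≤ R ∧ w ∉ Λ) →
      (¬ ∃ w x : HexVertex, hexGraph.Adj v w ∧ hexGraph.Adj w x ∧ x ≠ v ∧ x ∉ Λ ∧ w ∉ a) →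
      (¬ ∃ w : HexVertex, hexGraph.Adj v w ∧ w ∈ a) →
      ∀ w₀ w₁ w₂ : HexVertex, hexGraph.Adj v w₀ → hexGraph.Adj v w₁ → hexGraph.Adj v w₂ →
      w₀ ≠ w₁ → w₁ ≠ w₂ → w₀ ≠ w₂ →
      winding [hexMidpoint s(w₀, v), hexCenter v, hexMidpoint s(v, w₁)] = Real.pi / 3 →
      let x : ℝ := hexCriticalFugacity
      let α : ℝ := 1 + 2 * hexCriticalFugacity * Real.cos (5 * Real.pi / 24)
      let β : ℝ := 1 + 2 * hexCriticalFugacity * Real.cos (11 * Real.pi / 24)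
      let ω : ℂ := Complex.exp (2 * Real.pi * Complex.I / 3)
      let Z : (w p q : HexVertex) → HexMidEdgeSAW Λ a s(v, w) → ℝ :=
        fun w p q (γ : HexMidEdgeSAW Λ a s(v, w)) =>
        ∑ δ : HexMidEdgeSAW ((Λ \ γ.verts.toFinset).erase v) s(v, p) s(v, q), x ^ δ.length
      let B : (w p q : HexVertex) → ℂ := fun w p q =>
        ∑ γ : HexMidEdgeSAW Λ a s(v, w), if v ∉ γ.verts then
          γ.weight x (5 / 8) * ((β + Real.sqrt 3 * x * Z w p q γ : ℝ) : ℂ) else 0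
      let S : (w p q : HexVertex) → ℂ := fun w p q =>
        ∑ γ : HexMidEdgeSAW Λ a s(v, w), if v ∉ γ.verts then
          γ.weight x (5 / 8) * ((α - Real.sqrt 3 * x * Z w p q γ : ℝ) : ℂ) else 0
      ‖B w₀ w₁ w₂ + ω * B w₁ w₂ w₀ + ω ^ 2 * B w₂ w₀ w₁‖ ≤
        k * ‖S w₀ w₁ w₂ + S w₁ w₂ w₀ + S w₂ w₀ w₁‖)
    (hM : Summit.CriticalPhenomena.SAWScalingLimit.Theses.SAWDevelopingMap.InteriorFlattening) :
    Summit.CriticalPhenomena.SAWScalingLimit.Theses.SAWDevelopingMap.NoFoldBound := by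
  obtain ⟨k₁, hk₁, H₁⟩ := noFold_collarTwo hL hdom hdomSrc
  obtain ⟨R₀, HM⟩ := hM (1 / 2) one_half_pos
  obtain ⟨k₂, hk₂, H₂⟩ := depthThree_interior_of_hyp h3 R₀
  refine ⟨max (max k₁ k₂) (1 / 2), max_lt (max_lt hk₁ hk₂) one_half_lt_one, ?_⟩
  intro Λ hΛ a ha v hv w₀ w₁ w₂ h₀ h₁ h₂ h₀₁ h₁₂ h₀₂
  by_cases hb : v ∈ a ∨ (∃ u : HexVertex, hexGraph.Adj v u ∧ u ∉ Λ) ∨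
      ∃ w x : HexVertex, hexGraph.Adj v w ∧ hexGraph.Adj w x ∧ x ≠ v ∧ x ∉ Λ
  · -- the collar of depth ≤ 2
    have h := H₁ Λ hΛ a ha v hv hb w₀ w₁ w₂ h₀ h₁ h₂ h₀₁ h₁₂ h₀₂
    dsimp only at h ⊢
    exact h.trans (mul_le_mul_of_nonneg_right ((le_max_left _ _).trans (le_max_left _ _))
      (norm_nonneg _))
  · push Not at hb
    obtain ⟨hva, hint', h2'⟩ := hb
    have hint : ∀ u : HexVertex, hexGraph.Adj v u → u ∈ Λ := fun u hu => hint' u hu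
    have h2 : ∀ w x : HexVertex, hexGraph.Adj v w → hexGraph.Adj w x → x ≠ v → x ∈ Λ :=
      fun w x hvw hwx hxv => h2' w x hvw hwx hxv
    by_cases hd : ∀ w : HexVertex, dist (hexCenter w) (hexCenter v) ≤ R₀ → w ∈ Λ
    · -- `R₀`-deep vertices: interior flattening at `ε = 1/2`
      have h := HM Λ hΛ a ha v hv hd w₀ w₁ w₂ h₀ h₁ h₂ h₀₁ h₁₂ h₀₂
      dsimp only at h ⊢
      exact h.trans (mul_le_mul_of_nonneg_right (le_max_right _ _) (norm_nonneg _))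
    · -- depth ≥ 3, not `R₀`-deep
      push Not at hd
      have h := H₂ Λ hΛ a ha v hv hva hint h2 hd w₀ w₁ w₂ h₀ h₁ h₂ h₀₁ h₁₂ h₀₂
      dsimp only at h ⊢
      exact h.trans (mul_le_mul_of_nonneg_right ((le_max_right _ _).trans (le_max_left _ _))
        (norm_nonneg _))

end Summit.CriticalPhenomena.SAWScalingLimit.Theorems.SAWDevelopingMapNoFoldBound

end
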